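import Mathlib
import Literature.Probability.RandomMatrix.HaarUnitaryColumns
import Literature.Analysis.InnerProduct.GramSchmidt
import Summits.QuantumFields.YangMills.Theorems.EguchiKawaiDirectionLadderHaarColumnStep
import HarnessLib

/-!
# Nested-pattern small-ball bound for the columns of a Haar unitary

The probabilistic engine of stub B1 `stub_singleLinkRigidity` (crux `DirectionIncrement`, route
`EguchiKawaiDirectionLadder`). Let `T₀ ⊇ T₁ ⊇ ⋯` be index sets with `T_k ⊆ {j > k}` and thresholds
`y_k ≥ 0`. For a Haar-random `W ∈ U(N)`,

  `P(∀ k, ∑_{j ∈ T_k} |W_{jk}|² ≤ y_k) ≤ ∏_k 2^{N-1} (min(4 y_k, 1))^{|T_k| - ⌊2 ∑_{l<k} y_l⌋}`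

(`haar_measure_nestedPattern_le`): every constant is `e^{O(N²)}`, no `N^{N²}`. Proof: the columns of
`W` are the Gram–Schmidt orthonormalisation of independent standard Gaussian vectors
(`map_firstCols_haar_eq_map_gramSchmidtNormed` of the tree); peel the columns one at a time
(`measurePreserving_piFinSuccAbove`, Fubini): conditionally on the previous columns, the event for
column `k` is `‖P_{C_k}(P_{Kᗮ} g)‖² ≤ y_k ‖P_{Kᗮ} g‖²` (`K` the span of the previous columns,
`C_k` the coordinate subspace of `T_k`), and since `T_k ⊆ T_l` for `l < k` the previous columns
have `C_k`-mass at most `∑_{l<k} y_l`, so `stdGaussian_measure_column_event_le` applies.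
All [folklore].
-/

noncomputable section

open MeasureTheory ProbabilityTheory Module Submodule InnerProductSpace
open Literature.Probability.Distributions Literature.Probability.RandomMatrix
open Literature.Analysis.InnerProduct
open Literature.MathematicalPhysics.QuantumFieldTheory (haarProbability)
open scoped ENNReal InnerProductSpace

namespace Summit.QuantumFields.YangMills.Theorems.EguchiKawaiDirectionLadder.HaarColumns

variable {N : ℕ}

/-! ### Coordinate subspaces of `ℂ^N` -/

/-- The coordinate subspace `span {e_j : j ∈ T}` of `ℂ^N` has dimension `|T|` (the `e_j`, `j ∈ T`, are
an orthonormal basis, `OrthonormalBasis.span`). [folklore] -/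
theorem finrank_coordSubspace (T : Finset (Fin N)) :
    finrank ℂ (span ℂ (↑(Finset.image (fun j : Fin N => EuclideanSpace.single j (1 : ℂ)) T) : Set (EuclideanSpace ℂ (Fin N)))) = T.card := by
  classical
  rw [finrank_eq_card_basis
    (OrthonormalBasis.span (EuclideanSpace.orthonormal_single (ι := Fin N) (𝕜 := ℂ)) T).toBasis,
    Fintype.card_coe]

/-- `‖P_{span {e_j : j ∈ T}} v‖² = ∑_{j ∈ T} |v_j|²`. [folklore] -/
theorem norm_sq_starProjection_coordSubspace (T : Finset (Fin N)) (v : EuclideanSpace ℂ (Fin N)) :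
    ‖(span ℂ (↑(Finset.image (fun j : Fin N => EuclideanSpace.single j (1 : ℂ)) T) : Set (EuclideanSpace ℂ (Fin N)))).starProjection v‖ ^ 2 =
      ∑ j ∈ T, ‖v j‖ ^ 2 := by
  classical
  rw [norm_sq_starProjection_eq_sum _
      (OrthonormalBasis.span (EuclideanSpace.orthonormal_single (ι := Fin N) (𝕜 := ℂ)) T) v,
    ← Finset.sum_coe_sort T (fun j => ‖v j‖ ^ 2)]
  refine Finset.sum_congr rfl fun j _ => ?_
  rw [OrthonormalBasis.span_apply, EuclideanSpace.inner_single_left, map_one, one_mul]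

/-- Coordinate subspaces are monotone in the index set. [folklore] -/
theorem coordSubspace_mono {T T' : Finset (Fin N)} (h : T ⊆ T') :
    (span ℂ (↑(Finset.image (fun j : Fin N => EuclideanSpace.single j (1 : ℂ)) T) : Set (EuclideanSpace ℂ (Fin N)))) ≤
      (span ℂ (↑(Finset.image (fun j : Fin N => EuclideanSpace.single j (1 : ℂ)) T') : Set (EuclideanSpace ℂ (Fin N)))) :=
  Submodule.span_mono (Finset.coe_subset.2 (Finset.image_subset_image h))

/-- Projecting onto a smaller subspace does not increase the norm. [folklore] -/
theorem norm_starProjection_mono {E : Type*} [NormedAddCommGroup E] [InnerProductSpace ℂ E]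
    [FiniteDimensional ℂ E] {U U' : Submodule ℂ E} (h : U ≤ U') (v : E) :
    ‖U.starProjection v‖ ≤ ‖U'.starProjection v‖ := by
  have h' := congrFun (congrArg DFunLike.coe
    (starProjection_comp_starProjection_of_le (U := U) (V := U') h)) v
  rw [ContinuousLinearMap.coe_comp, Function.comp_apply] at h'
  rw [← h']
  exact norm_starProjection_apply_le (K := U) (U'.starProjection v)

/-- The residual of the projection onto `K` is the projection onto `Kᗮ`. [folklore] -/
theorem sub_starProjection_eq {E : Type*} [NormedAddCommGroup E] [InnerProductSpace ℂ E]
    [FiniteDimensional ℂ E] (K : Submodule ℂ E) (v : E) :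
    v - K.starProjection v = Kᗮ.starProjection v := by
  have := K.starProjection_add_starProjection_orthogonal v
  rw [sub_eq_iff_eq_add']
  exact this.symm

/-! ### The column events -/

section Columns

variable (T : ℕ → Finset (Fin N)) (y : ℕ → ℝ)

/-- The column events "each of the first `q` Gram–Schmidt columns has `T_k`-mass at most `y_k`"
are measurable. [folklore] -/
theorem measurableSet_colEvent (q : ℕ) :
    MeasurableSet {f : Fin q → EuclideanSpace ℂ (Fin N) | ∀ k : Fin q,
      ‖(span ℂ (↑(Finset.image (fun j : Fin N => EuclideanSpace.single j (1 : ℂ)) (T k)) : Set (EuclideanSpace ℂ (Fin N)))).starProjection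
          (gramSchmidtNormed ℂ f k)‖ ^ 2 ≤ y k} := by
  have h : {f : Fin q → EuclideanSpace ℂ (Fin N) | ∀ k : Fin q,
      ‖(span ℂ (↑(Finset.image (fun j : Fin N => EuclideanSpace.single j (1 : ℂ)) (T k)) : Set (EuclideanSpace ℂ (Fin N)))).starProjection
          (gramSchmidtNormed ℂ f k)‖ ^ 2 ≤ y k} =
      ⋂ k : Fin q, {f : Fin q → EuclideanSpace ℂ (Fin N) |
      ‖(span ℂ (↑(Finset.image (fun j : Fin N => EuclideanSpace.single j (1 : ℂ)) (T k)) : Set (EuclideanSpace ℂ (Fin N)))).starProjection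
          (gramSchmidtNormed ℂ f k)‖ ^ 2 ≤ y k} := by
    ext f; simp
  rw [h]
  refine MeasurableSet.iInter fun k => measurableSet_le ?_ measurable_const
  exact ((span ℂ (↑(Finset.image (fun j : Fin N => EuclideanSpace.single j (1 : ℂ)) (T k)) : Set (EuclideanSpace ℂ (Fin N)))).starProjection.continuous.measurable.comp
    (measurable_gramSchmidtNormed_apply ℂ k)).norm.pow_const 2

variable {T y}

/-- A costly set `T_k ⊆ {j > k}` is a proper subset of the index set (`0 ∉ T_k`). [folklore] -/
theorem card_lt_of_lt (hT : ∀ k, ∀ j ∈ T k, k < (j : ℕ)) (k : ℕ) (hN : 0 < N) :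
    (T k).card < N := by
  have h0 : (⟨0, hN⟩ : Fin N) ∉ T k := fun h => by simpa using hT k _ h
  calc (T k).card < (Finset.univ : Finset (Fin N)).card :=
        Finset.card_lt_card ⟨Finset.subset_univ _, fun h => h0 (h (Finset.mem_univ _))⟩
    _ = N := by simp

/-- **The conditional bound for one more column.** For linearly independent `f = (g₁,…,g_q)` in the
column event, the standard Gaussian measure of the `g` for which the new Gram–Schmidt column has
`T_q`-mass at most `y_q` is at most `colBound q`. [folklore] -/
theorem stdGaussian_measure_newColumn_le (hT : ∀ k, ∀ j ∈ T k, k < (j : ℕ))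
    (hTmono : ∀ k l, k ≤ l → T l ⊆ T k) (hy0 : ∀ k, 0 ≤ y k)
    {q : ℕ} (hqN : q < N) {f : Fin q → EuclideanSpace ℂ (Fin N)} (hli : LinearIndependent ℂ f)
    (hf : f ∈ {f : Fin q → EuclideanSpace ℂ (Fin N) | ∀ k : Fin q,
      ‖(span ℂ (↑(Finset.image (fun j : Fin N => EuclideanSpace.single j (1 : ℂ)) (T k)) : Set (EuclideanSpace ℂ (Fin N)))).starProjection
          (gramSchmidtNormed ℂ f k)‖ ^ 2 ≤ y k}) :
    stdGaussian (EuclideanSpace ℂ (Fin N))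
        {g | ‖(span ℂ (↑(Finset.image (fun j : Fin N => EuclideanSpace.single j (1 : ℂ)) (T q)) : Set (EuclideanSpace ℂ (Fin N)))).starProjection
            ((span ℂ (Set.range f))ᗮ.starProjection g)‖ ^ 2 ≤
          y q * ‖(span ℂ (Set.range f))ᗮ.starProjection g‖ ^ 2} ≤
      ENNReal.ofReal (2 ^ (N - 1) * (min (4 * y q) 1) ^ ((T q).card - ⌊2 * ∑ l ∈ Finset.range q, y l⌋₊)) := by
  -- the trivial regime `y_q ≥ 1/4`: the bound is at least `1`
  by_cases hy4 : 1 / 4 ≤ y q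
  · refine prob_le_one.trans ?_
    rw [min_eq_right (by linarith), one_pow, mul_one]
    exact ENNReal.one_le_ofReal.2 (one_le_pow₀ (by norm_num))
  push Not at hy4
  -- the Gram–Schmidt basis of `K = span f`
  set e : Fin q → EuclideanSpace ℂ (Fin N) := gramSchmidtNormed ℂ f with he
  have hon : Orthonormal ℂ e := gramSchmidtNormed_orthonormal hli
  have hKf : span ℂ (Set.range f) = span ℂ (Set.range e) := by
    rw [he, span_gramSchmidtNormed_range, span_gramSchmidt]
  rw [hKf]
  set K : Submodule ℂ (EuclideanSpace ℂ (Fin N)) := span ℂ (Set.range e) with hK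
  let fK : Fin q → K := fun j => ⟨e j, subset_span (Set.mem_range_self j)⟩
  have hfK : Orthonormal ℂ fK := by
    have hon' := hon
    rw [orthonormal_iff_ite] at hon' ⊢
    intro i j
    rw [Submodule.coe_inner]
    exact hon' i j
  have hrange : Set.range fK = ((↑) : K → EuclideanSpace ℂ (Fin N)) ⁻¹' Set.range e := by
    ext x
    constructor
    · rintro ⟨j, rfl⟩; exact ⟨j, rfl⟩
    · rintro ⟨j, hj⟩; exact ⟨j, Subtype.ext hj⟩
  let w : OrthonormalBasis (Fin q) ℂ K := OrthonormalBasis.mk hfK (by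
    rw [hrange, Submodule.span_span_coe_preimage])
  have hw : ∀ l, (w l : EuclideanSpace ℂ (Fin N)) = e l := fun l => by simp [w, fK]
  -- the previous columns have small `C_q`-mass
  have hσ : ∑ l, ‖(span ℂ (↑(Finset.image (fun j : Fin N => EuclideanSpace.single j (1 : ℂ)) (T q)) : Set (EuclideanSpace ℂ (Fin N)))).starProjection
      (w l : EuclideanSpace ℂ (Fin N))‖ ^ 2 ≤ ∑ l ∈ Finset.range q, y l := by
    rw [← Fin.sum_univ_eq_sum_range]
    refine Finset.sum_le_sum fun l _ => ?_
    rw [hw]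
    have h1 := norm_starProjection_mono (coordSubspace_mono (hTmono l q l.2.le)) (e l)
    have h2 := hf l
    calc ‖(span ℂ (↑(Finset.image (fun j : Fin N => EuclideanSpace.single j (1 : ℂ)) (T q)) : Set (EuclideanSpace ℂ (Fin N)))).starProjection (e l)‖ ^ 2
        ≤ ‖(span ℂ (↑(Finset.image (fun j : Fin N => EuclideanSpace.single j (1 : ℂ)) (T l)) : Set (EuclideanSpace ℂ (Fin N)))).starProjection (e l)‖ ^ 2 := by gcongr
      _ ≤ y l := h2
  have hCN : finrank ℂ (span ℂ (↑(Finset.image (fun j : Fin N => EuclideanSpace.single j (1 : ℂ)) (T q)) : Set (EuclideanSpace ℂ (Fin N)))) < N := by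
    rw [finrank_coordSubspace]; exact card_lt_of_lt hT q (by omega)
  have h := stdGaussian_measure_column_event_le K _ w hσ hCN (hy0 q) hy4.le
  rw [finrank_coordSubspace] at h
  rw [min_eq_left (by linarith)]
  exact h

/-- **Column induction**: `γ^{⊗q}(colEvent q) ≤ ∏_{k<q} colBound k` for `q ≤ N`. [folklore] -/
theorem gaussianCols_colEvent_le (hT : ∀ k, ∀ j ∈ T k, k < (j : ℕ))
    (hTmono : ∀ k l, k ≤ l → T l ⊆ T k) (hy0 : ∀ k, 0 ≤ y k) :
    ∀ q, q ≤ N → gaussianCols N q {f : Fin q → EuclideanSpace ℂ (Fin N) | ∀ k : Fin q,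
      ‖(span ℂ (↑(Finset.image (fun j : Fin N => EuclideanSpace.single j (1 : ℂ)) (T k)) : Set (EuclideanSpace ℂ (Fin N)))).starProjection
          (gramSchmidtNormed ℂ f k)‖ ^ 2 ≤ y k} ≤
      ∏ k ∈ Finset.range q, ENNReal.ofReal (2 ^ (N - 1) * (min (4 * y k) 1) ^ ((T k).card - ⌊2 * ∑ l ∈ Finset.range k, y l⌋₊)) := by
  intro q
  induction q with
  | zero =>
    intro _
    rw [Finset.prod_range_zero]
    exact prob_le_one
  | succ q ih =>
    intro hq
    have hqN : q < N := hq
    have IH := ih hqN.le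
    set Vv := EuclideanSpace ℂ (Fin N) with hVv
    set γ : Measure Vv := stdGaussian Vv with hγ
    -- split off the last vector
    set eV := MeasurableEquiv.piFinSuccAbove (fun _ : Fin (q + 1) => Vv) (Fin.last q) with heV
    have hmp : MeasurePreserving eV (gaussianCols N (q + 1)) (γ.prod (gaussianCols N q)) :=
      measurePreserving_piFinSuccAbove (fun _ : Fin (q + 1) => stdGaussian Vv) (Fin.last q)
    have heV_symm : ∀ p : Vv × (Fin q → Vv), eV.symm p = Fin.snoc p.2 p.1 := by
      intro p
      rw [heV, MeasurableEquiv.piFinSuccAbove_symm_apply, Fin.insertNthEquiv_last]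
      rfl
    -- the residual of the new vector
    set R : Vv × (Fin q → Vv) → Vv :=
      fun p => gramSchmidt ℂ (Fin.snoc p.2 p.1 : Fin (q + 1) → Vv) (Fin.last q) with hR
    have hRm : Measurable R :=
      (measurable_gramSchmidt_apply ℂ (Fin.last q)).comp (continuous_snoc q).measurable
    have hRK : ∀ (g : Vv) (f : Fin q → Vv),
        R (g, f) = (span ℂ (Set.range f))ᗮ.starProjection g := by
      intro g f
      rw [hR]
      dsimp only
      rw [gramSchmidt_last_eq_sub_starProjection, Fin.snoc_comp_castSucc, Fin.snoc_last,
        sub_starProjection_eq]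
    -- the joint event
    set Aq : Set (Fin q → Vv) := {f : Fin q → EuclideanSpace ℂ (Fin N) | ∀ k : Fin q,
      ‖(span ℂ (↑(Finset.image (fun j : Fin N => EuclideanSpace.single j (1 : ℂ)) (T k)) : Set (EuclideanSpace ℂ (Fin N)))).starProjection
          (gramSchmidtNormed ℂ f k)‖ ^ 2 ≤ y k} with hAq
    set Cq : Submodule ℂ Vv := (span ℂ (↑(Finset.image (fun j : Fin N => EuclideanSpace.single j (1 : ℂ)) (T q)) : Set (EuclideanSpace ℂ (Fin N)))) with hCq
    set J : Set (Vv × (Fin q → Vv)) := {p | p.2 ∈ Aq} ∩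
      {p | ‖Cq.starProjection (R p)‖ ^ 2 ≤ y q * ‖R p‖ ^ 2} with hJ
    have hJm : MeasurableSet J := by
      refine (measurable_snd (measurableSet_colEvent T y q)).inter (measurableSet_le ?_ ?_)
      · exact (Cq.starProjection.continuous.measurable.comp hRm).norm.pow_const 2
      · exact (hRm.norm.pow_const 2).const_mul _
    have hsub : eV.symm ⁻¹' {f : Fin (q + 1) → EuclideanSpace ℂ (Fin N) | ∀ k : Fin (q + 1),
      ‖(span ℂ (↑(Finset.image (fun j : Fin N => EuclideanSpace.single j (1 : ℂ)) (T k)) : Set (EuclideanSpace ℂ (Fin N)))).starProjection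
          (gramSchmidtNormed ℂ f k)‖ ^ 2 ≤ y k} ⊆ J := by
      intro p hp
      rw [Set.mem_preimage, heV_symm] at hp
      refine ⟨fun k => ?_, ?_⟩
      · have h := hp (Fin.castSucc k)
        rw [← gramSchmidtNormed_comp_castSucc ℂ (Fin.snoc p.2 p.1 : Fin (q + 1) → Vv) k,
          Fin.snoc_comp_castSucc] at h
        simp only [Fin.val_castSucc] at h
        exact h
      · have h := hp (Fin.last q)
        simp only [Fin.val_last] at h
        unfold gramSchmidtNormed at h
        rw [map_smul, norm_smul, norm_inv, RCLike.norm_ofReal, abs_norm, mul_pow, inv_pow] at h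
        change (‖R p‖ ^ 2)⁻¹ * ‖Cq.starProjection (R p)‖ ^ 2 ≤ y q at h
        show ‖Cq.starProjection (R p)‖ ^ 2 ≤ y q * ‖R p‖ ^ 2
        by_cases h0 : ‖R p‖ = 0
        · have : R p = 0 := norm_eq_zero.1 h0
          rw [this, map_zero, norm_zero]
          simp
        · have hpos : 0 < ‖R p‖ ^ 2 := by positivity
          have := mul_le_mul_of_nonneg_right h hpos.le
          rwa [mul_comm, ← mul_assoc, mul_inv_cancel₀ hpos.ne', one_mul] at this
    -- the conditional bound, almost everywhere in the previous columns
    have hae : ∀ᵐ f ∂(gaussianCols N q),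
        γ ((fun g : Vv => (g, f)) ⁻¹' J) ≤ Aq.indicator (fun _ => ENNReal.ofReal (2 ^ (N - 1) * (min (4 * y q) 1) ^ ((T q).card - ⌊2 * ∑ l ∈ Finset.range q, y l⌋₊))) f := by
      filter_upwards [ae_linearIndependent_gaussianCols (m := N) hqN.le] with f hli
      by_cases hf : f ∈ Aq
      · rw [Set.indicator_of_mem hf]
        have hset : (fun g : Vv => (g, f)) ⁻¹' J =
            {g | ‖Cq.starProjection ((span ℂ (Set.range f))ᗮ.starProjection g)‖ ^ 2 ≤
              y q * ‖(span ℂ (Set.range f))ᗮ.starProjection g‖ ^ 2} := by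
          ext g
          simp only [hJ, Set.mem_preimage, Set.mem_inter_iff, Set.mem_setOf_eq, hRK g f]
          exact ⟨fun h => h.2, fun h => ⟨hf, h⟩⟩
        rw [hset]
        exact stdGaussian_measure_newColumn_le hT hTmono hy0 hqN hli hf
      · rw [Set.indicator_of_notMem hf]
        have hset : (fun g : Vv => (g, f)) ⁻¹' J = ∅ := by
          ext g
          simp only [hJ, Set.mem_preimage, Set.mem_inter_iff, Set.mem_setOf_eq, Set.mem_empty_iff_false,
            iff_false, not_and]
          exact fun h _ => hf h
        rw [hset, measure_empty]
    calc gaussianCols N (q + 1) {f : Fin (q + 1) → EuclideanSpace ℂ (Fin N) | ∀ k : Fin (q + 1),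
      ‖(span ℂ (↑(Finset.image (fun j : Fin N => EuclideanSpace.single j (1 : ℂ)) (T k)) : Set (EuclideanSpace ℂ (Fin N)))).starProjection
          (gramSchmidtNormed ℂ f k)‖ ^ 2 ≤ y k}
        = (γ.prod (gaussianCols N q)) (eV.symm ⁻¹' {f : Fin (q + 1) → EuclideanSpace ℂ (Fin N) | ∀ k : Fin (q + 1),
      ‖(span ℂ (↑(Finset.image (fun j : Fin N => EuclideanSpace.single j (1 : ℂ)) (T k)) : Set (EuclideanSpace ℂ (Fin N)))).starProjection
          (gramSchmidtNormed ℂ f k)‖ ^ 2 ≤ y k}) :=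
          (hmp.symm.measure_preimage_equiv _).symm
      _ ≤ (γ.prod (gaussianCols N q)) J := measure_mono hsub
      _ = ∫⁻ f, γ ((fun g : Vv => (g, f)) ⁻¹' J) ∂(gaussianCols N q) := Measure.prod_apply_symm hJm
      _ ≤ ∫⁻ f, Aq.indicator (fun _ => ENNReal.ofReal (2 ^ (N - 1) * (min (4 * y q) 1) ^ ((T q).card - ⌊2 * ∑ l ∈ Finset.range q, y l⌋₊))) f ∂(gaussianCols N q) :=
          lintegral_mono_ae hae
      _ = ENNReal.ofReal (2 ^ (N - 1) * (min (4 * y q) 1) ^ ((T q).card - ⌊2 * ∑ l ∈ Finset.range q, y l⌋₊)) * gaussianCols N q Aq :=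
          lintegral_indicator_const (measurableSet_colEvent T y q) _
      _ ≤ ENNReal.ofReal (2 ^ (N - 1) * (min (4 * y q) 1) ^ ((T q).card - ⌊2 * ∑ l ∈ Finset.range q, y l⌋₊)) *
            ∏ k ∈ Finset.range q, ENNReal.ofReal (2 ^ (N - 1) * (min (4 * y k) 1) ^ ((T k).card - ⌊2 * ∑ l ∈ Finset.range k, y l⌋₊)) := by
          gcongr
      _ = ∏ k ∈ Finset.range (q + 1), ENNReal.ofReal (2 ^ (N - 1) * (min (4 * y k) 1) ^ ((T k).card - ⌊2 * ∑ l ∈ Finset.range k, y l⌋₊)) := by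
          rw [Finset.prod_range_succ, mul_comm]

/-- **Nested-pattern small-ball bound for Haar unitaries.** Let `T : ℕ → Finset (Fin N)` be
non-increasing with `T k ⊆ {j : k < j}` and `y_k ≥ 0`. Then
`Haar{W ∈ U(N) : ∀ k, ∑_{j ∈ T_k} |W_{jk}|² ≤ y_k} ≤ ∏_{k<N} 2^{N-1}(min(4y_k,1))^{|T_k| - ⌊2∑_{l<k} y_l⌋}`.
[folklore] -/
theorem haar_measure_nestedPattern_le (T : ℕ → Finset (Fin N)) (y : ℕ → ℝ)
    (hT : ∀ k, ∀ j ∈ T k, k < (j : ℕ)) (hTmono : ∀ k l, k ≤ l → T l ⊆ T k)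
    (hy0 : ∀ k, 0 ≤ y k) :
    haarProbability (Matrix.unitaryGroup (Fin N) ℂ)
        {W | ∀ k : Fin N, ∑ j ∈ T k, ‖(W : Matrix (Fin N) (Fin N) ℂ) j k‖ ^ 2 ≤ y k} ≤
      ∏ k ∈ Finset.range N, ENNReal.ofReal (2 ^ (N - 1) * (min (4 * y k) 1) ^ ((T k).card - ⌊2 * ∑ l ∈ Finset.range k, y l⌋₊)) := by
  set D : Set (Fin N → EuclideanSpace ℂ (Fin N)) :=
    {u | ∀ k : Fin N, ∑ j ∈ T k, ‖u k j‖ ^ 2 ≤ y k} with hD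
  have hDm : MeasurableSet D := by
    have h : D = ⋂ k : Fin N, {u : Fin N → EuclideanSpace ℂ (Fin N) | ∑ j ∈ T k, ‖u k j‖ ^ 2 ≤ y k} := by
      ext u; simp [hD]
    rw [h]
    refine MeasurableSet.iInter fun k => measurableSet_le ?_ measurable_const
    refine Finset.measurable_sum _ fun j _ => ?_
    exact (((measurable_pi_apply j).comp ((measurable_ofLp_two (Fin N)).comp
      (measurable_pi_apply k))).norm).pow_const 2
  have hpre : {W : Matrix.unitaryGroup (Fin N) ℂ |
      ∀ k : Fin N, ∑ j ∈ T k, ‖(W : Matrix (Fin N) (Fin N) ℂ) j k‖ ^ 2 ≤ y k} =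
      firstCols N N le_rfl ⁻¹' D := by
    ext W
    simp only [Set.mem_setOf_eq, Set.mem_preimage, hD, firstCols_apply, Fin.castLE_rfl, id_eq]
  have hGSN : gramSchmidtNormed ℂ ⁻¹' D = {f : Fin N → EuclideanSpace ℂ (Fin N) | ∀ k : Fin N,
      ‖(span ℂ (↑(Finset.image (fun j : Fin N => EuclideanSpace.single j (1 : ℂ)) (T k)) : Set (EuclideanSpace ℂ (Fin N)))).starProjection
          (gramSchmidtNormed ℂ f k)‖ ^ 2 ≤ y k} := by
    ext f
    simp only [Set.mem_preimage, hD, Set.mem_setOf_eq, norm_sq_starProjection_coordSubspace]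
  rw [hpre, ← Measure.map_apply (continuous_firstCols N le_rfl).measurable hDm,
    map_firstCols_haar_eq_map_gramSchmidtNormed le_rfl,
    Measure.map_apply (measurable_gramSchmidtNormed ℂ) hDm, hGSN]
  exact gaussianCols_colEvent_le hT hTmono hy0 N le_rfl

end Columns

end Summit.QuantumFields.YangMills.Theorems.EguchiKawaiDirectionLadder.HaarColumns

end
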